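import Summits.ResolutionOfSingularities.ResolutionOfSingularities.Theorems.PAlterationPialtPiTransfer
import Literature.AlgebraicGeometry.Resolution.LocalUniformization
import Literature.AlgebraicGeometry.Resolution.ProjectiveModelsCharts
import Literature.AlgebraicGeometry.Resolution.ZariskiFiniteness
import Literature.AlgebraicGeometry.Resolution.FieldsJ2
import HarnessLib

/-!
# Crux `Pialt` (stmt-ResolutionOfSingularities-0555), PiTMP programme: the ENGINE — Temkin's inseparable local
# uniformization and purely inseparable two-model patching produce a REGULAR purely inseparable model

Line lead c5 (prover-line-stmt-ResolutionOfSingularities-0555-c5-0, 2026-08-17).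

**Purely inseparable two-model patching** (`PiTMP_p`, registered stub `stub_piTwoModelPatching` of the crux; here a
hypothesis `hZ`, binders verbatim): for proper models `M₁` of `L₁` and `M₂` of `L₂`, `Lᵢ/K` finite purely
inseparable, there are a finite purely inseparable `L ⊇ L₁, L₂` and a proper model `N` of `L` dominating both `Mᵢ`
along `Lᵢ → L` which is regular at every point lying over a regular point of `M₁` or of `M₂`. It is Piltant's
two-model patching (Prop. 5.1, `P = P_reg`) with the field allowed to GROW by purely inseparable extensions — the
freedom the crux `Pialt` (Abramovich–Oort) grants and weak resolution does not.

* `exists_regular_piModel_of_temkin2013_of_piTwoModelPatching` — **THE ENGINE.** `Temkin2013` (Temkin 2013,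
  Thm. 1.3.2, weak form: every valuation of a finitely generated `K/k` is uniformized on SOME finite purely
  inseparable extension) and `PiTMP_p` at the field `k` of characteristic `p` give, for every proper model `M₀` of
  `K/k`, a finite purely inseparable `L/K` and a REGULAR proper model `N` of `L/k` dominating `M₀` along `K → L`.
  Proof (Zariski 1944 / Piltant 2013 Cor. 5.7 with twisted models): per valuation `v` Temkin gives `(L_v, B_v)` with
  `B_v ⊆ L_v` regular at the centre of the unique extension of `v`; the loci
  `U_v = {w : B_v regular at the centre of the extension of w}` are open in the quasi-compact `Zar(K/k)`
  (`ZariskiRiemannSpace.continuous_of_comap_eq`, `isOpen_setOf_hasRegularCentre`), so finitely many suffice;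
  projective closures `M_v` of the `B_v` (`ProjModel.exists_regCentre_of_hasRegularCentre`); patch `M₀` with the
  `M_v` one at a time by `PiTMP_p`, the field growing at each step, regular centres being carried up by
  `ProperModel.regCentre_of_comap_eq`; at the end every valuation of the final field has a regular centre, so the
  final model is regular (`ProperModel.isRegular_of_forall_regCentre`).

The conversion of the output into the conclusion of the crux (relative normalisation of `M₀` in `N`: finite,
radicial, surjective, resolved by `N`) and the exactness `Pialt ⟹ PiTMP` are separate files of the programme.

References: O. Zariski, Ann. of Math. 45 (1944), Fundamental Theorem p. 539; O. Piltant, RACSAM 107 (2013), Prop. 5.1,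
Cor. 5.7; M. Temkin, J. Algebra 373 (2013), Thm. 1.3.2, §1.3 ("no global fibration suits all valuations").
-/

set_option linter.dupNamespace false

noncomputable section

open CategoryTheory AlgebraicGeometry IsLocalRing
open Literature.AlgebraicGeometry.Resolution

namespace Summit.ResolutionOfSingularities.ResolutionOfSingularities.Theorems.Pialt.PiPatching

/-- **THE ENGINE of the PiTMP programme.** `Temkin2013` and purely inseparable two-model patching at a field `k` of
characteristic `p` give, for every proper model `M₀` of a finitely generated `K/k`, a finite purely inseparable
extension `L/K` and a REGULAR proper model `N` of `L/k` together with a `k`-morphism `N → M₀` compatible with the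
generic points along `K → L`. [cite: Piltant2013, Prop. 5.1 and Cor. 5.7] [cite: Temkin2013, Thm. 1.3.2] -/
theorem exists_regular_piModel_of_temkin2013_of_piTwoModelPatching {p : ℕ} (hT : Temkin2013.{0})
    (k : Type) [Field k] [CharP k p]
    (hZ : ∀ (K : Type) [Field K] [Algebra k K]
      (L₁ : Type) [Field L₁] [Algebra K L₁] [Algebra k L₁] [IsScalarTower k K L₁]
      [FiniteDimensional K L₁] [IsPurelyInseparable K L₁]
      (L₂ : Type) [Field L₂] [Algebra K L₂] [Algebra k L₂] [IsScalarTower k K L₂]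
      [FiniteDimensional K L₂] [IsPurelyInseparable K L₂]
      (M₁ : ProperModel k L₁) (M₂ : ProperModel k L₂),
      ∃ (L : Type) (_ : Field L) (_ : Algebra K L) (_ : Algebra k L) (_ : IsScalarTower k K L)
        (ι₁ : L₁ →ₐ[K] L) (ι₂ : L₂ →ₐ[K] L),
        FiniteDimensional K L ∧ IsPurelyInseparable K L ∧
        ∃ (N : ProperModel k L) (φ₁ : N.X ⟶ M₁.X) (φ₂ : N.X ⟶ M₂.X),
          φ₁ ≫ M₁.π = N.π ∧ φ₂ ≫ M₂.π = N.π ∧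
          N.gen ≫ φ₁ = Spec.map (CommRingCat.ofHom ι₁.toRingHom) ≫ M₁.gen ∧
          N.gen ≫ φ₂ = Spec.map (CommRingCat.ofHom ι₂.toRingHom) ≫ M₂.gen ∧
          ∀ n : N.X, (IsRegularLocalRing (M₁.X.presheaf.stalk (φ₁.base n)) ∨
              IsRegularLocalRing (M₂.X.presheaf.stalk (φ₂.base n))) →
            IsRegularLocalRing (N.X.presheaf.stalk n))
    (K : Type) [Field K] [Algebra k K] (hKfg : (⊤ : IntermediateField k K).FG) (M₀ : ProperModel k K) :
    ∃ (L : Type) (_ : Field L) (_ : Algebra K L) (_ : Algebra k L) (_ : IsScalarTower k K L),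
      FiniteDimensional K L ∧ IsPurelyInseparable K L ∧
      ∃ (N : ProperModel k L) (φ : N.X ⟶ M₀.X), φ ≫ M₀.π = N.π ∧
        N.gen ≫ φ = Spec.map (CommRingCat.ofHom (algebraMap K L)) ≫ M₀.gen ∧ Scheme.IsRegular N.X := by
  classical
  /- Step 1: Temkin's local data per valuation `v` of `K/k`: a finite purely inseparable `L_v`, the extension
  `O'_v` of `v`, and a finitely generated `B_v ⊆ O'_v` with `Frac B_v = L_v`, regular at the centre. -/
  have hloc : ∀ v : ZariskiRiemannSpace k K, ∃ (L : Type) (_ : Field L) (_ : Algebra K L) (_ : Algebra k L)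
      (_ : IsScalarTower k K L), FiniteDimensional K L ∧ IsPurelyInseparable K L ∧
      ∃ O' : ValuationSubring L, O'.comap (algebraMap K L) = v.asValuationSubring ∧
      ∃ B : Subalgebra k L, B.FG ∧ IsFractionRing B L ∧
        ∃ hB : B.toSubring ≤ O'.toSubring, IsRegularLocalRing (Localization.AtPrime
          (Ideal.comap (Subring.inclusion hB) (IsLocalRing.maximalIdeal O'))) := by
    intro v
    obtain ⟨L, iF, iA, ia, itw, hfin, hpi, O', hO', A, hA, hAfg, hAfr, hreg⟩ :=
      hT k K hKfg v.asValuationSubring v.algebraMap_mem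
    exact ⟨L, iF, iA, ia, itw, hfin, hpi, O', hO', A, hAfg, hAfr, hA, hreg⟩
  choose Lv iF iA ia itw hfin hpi O' hO' B hBfg hBfr hBO hBreg using hloc
  /- Step 2: the unique extension of valuations `Zar(K/k) → Zar(L_v/k)` and the open loci `U_v`. -/
  have hext : ∀ (v w : ZariskiRiemannSpace k K), ∃ w' : ZariskiRiemannSpace k (Lv v),
      w'.asValuationSubring.comap (algebraMap K (Lv v)) = w.asValuationSubring :=
    fun v w => ZariskiRiemannSpace.exists_comap_eq (L := Lv v) w
  choose E hE using hext
  let U : ZariskiRiemannSpace k K → Set (ZariskiRiemannSpace k K) := fun v =>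
    {w | ZariskiRiemannSpace.HasRegularCentre (B v) (E v w)}
  have hUo : ∀ v, IsOpen (U v) := fun v =>
    (ZariskiRiemannSpace.isOpen_setOf_hasRegularCentre (hBfg v)
      ((isJ2Ring_of_field k).2 (B v) ((Subalgebra.fg_iff_finiteType _).mp (hBfg v)))).preimage
      (ZariskiRiemannSpace.continuous_of_comap_eq (E v) (hE v))
  have hUmem : ∀ v, v ∈ U v := by
    intro v
    let v' : ZariskiRiemannSpace k (Lv v) :=
      ⟨O' v, algebraMap_mem_of_comap_eq v.asValuationSubring (hO' v) v.algebraMap_mem⟩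
    have hEv : E v v = v' := ZariskiRiemannSpace.eq_of_comap_eq (E v) (hE v) v v' (hO' v)
    change ZariskiRiemannSpace.HasRegularCentre (B v) (E v v)
    rw [hEv]
    exact ⟨hBO v, hBreg v⟩
  /- Step 3: quasi-compactness of `Zar(K/k)`: finitely many `U_v` cover. -/
  obtain ⟨t, ht⟩ := CompactSpace.elim_nhds_subcover U fun w => (hUo w).mem_nhds (hUmem w)
  have hcov : ∀ w : ZariskiRiemannSpace k K, ∃ v ∈ t, w ∈ U v := by
    intro w
    have hw : w ∈ ⋃ x ∈ t, U x := by rw [ht]; trivial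
    simpa only [Set.mem_iUnion, exists_prop] using hw
  /- Step 4: projective closures of the `B_v`: proper models `M_v` of `L_v` with regular centres where `B_v` has. -/
  have hM : ∀ v : ZariskiRiemannSpace k K, ∃ M : ProjModel k (Lv v), ∀ w' : ZariskiRiemannSpace k (Lv v),
      ZariskiRiemannSpace.HasRegularCentre (B v) w' → M.RegCentre w' := fun v => by
    haveI := hBfr v
    exact ProjModel.exists_regCentre_of_hasRegularCentre (B v) (hBfg v)
  choose Mv hMv using hM
  /- Step 5: patch `M₀` with the `M_v`, `v` in a finite list, the field growing at each step. -/
  have key : ∀ l : List (ZariskiRiemannSpace k K), ∃ (L : Type) (_ : Field L) (_ : Algebra K L)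
      (_ : Algebra k L) (_ : IsScalarTower k K L), FiniteDimensional K L ∧ IsPurelyInseparable K L ∧
      ∃ (N : ProperModel k L) (φ : N.X ⟶ M₀.X), φ ≫ M₀.π = N.π ∧
        N.gen ≫ φ = Spec.map (CommRingCat.ofHom (algebraMap K L)) ≫ M₀.gen ∧
        ∀ w : ZariskiRiemannSpace k K, (∃ v ∈ l, w ∈ U v) →
          ∀ w' : ZariskiRiemannSpace k L,
            w'.asValuationSubring.comap (algebraMap K L) = w.asValuationSubring → N.RegCentre w' := by
    intro l
    induction l with
    | nil =>
      refine ⟨K, inferInstance, Algebra.id K, inferInstance, IsScalarTower.right, inferInstance,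
        inferInstance, M₀, 𝟙 _, by simp, ?_, ?_⟩
      · rw [Category.comp_id, Algebra.algebraMap_self, CommRingCat.ofHom_id]
        erw [Spec.map_id]
        rw [Category.id_comp]
      · rintro w ⟨v, hv, -⟩
        simp at hv
    | cons v l ih =>
      obtain ⟨L, iFL, iAL, iaL, itL, hfinL, hpiL, N, φ, hφπ, hφgen, hinv⟩ := ih
      obtain ⟨L', iF', iA', ia', it', ι₁, ι₂, hfin', hpi', N', φ₁, φ₂, h1π, h2π, h1gen, h2gen, hregle⟩ :=
        hZ K L (Lv v) N (Mv v).toProperModel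
      refine ⟨L', iF', iA', ia', it', hfin', hpi', N', φ₁ ≫ φ, ?_, ?_, ?_⟩
      · rw [Category.assoc, hφπ, h1π]
      · rw [← Category.assoc, h1gen, Category.assoc, hφgen, ← Category.assoc, ← Spec.map_comp,
          ← CommRingCat.ofHom_comp]
        congr 3
        ext x
        exact ι₁.commutes x
      · intro w hw w' hw'
        obtain ⟨v₀, hv₀, hwU⟩ := hw
        -- restriction of `w'` to an intermediate field along a `K`-algebra map
        have hres : ∀ (F : Type) [Field F] [Algebra K F] [Algebra k F] [IsScalarTower k K F]
            (ι : F →ₐ[K] L'),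
            ∃ w₁ : ZariskiRiemannSpace k F, w₁.asValuationSubring = w'.asValuationSubring.comap ι.toRingHom ∧
              w₁.asValuationSubring.comap (algebraMap K F) = w.asValuationSubring := by
          intro F _ _ _ _ ι
          have hιK : ι.toRingHom.comp (algebraMap K F) = algebraMap K L' := by
            ext x; exact ι.commutes x
          refine ⟨⟨w'.asValuationSubring.comap ι.toRingHom, fun c => ?_⟩, rfl, ?_⟩
          · rw [ValuationSubring.mem_comap, IsScalarTower.algebraMap_apply k K F]
            change ι.toRingHom.comp (algebraMap K F) (algebraMap k K c) ∈ w'.asValuationSubring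
            rw [hιK, ← IsScalarTower.algebraMap_apply]
            exact w'.algebraMap_mem c
          · rw [← hw']
            ext x
            simp only [ValuationSubring.mem_comap]
            change ι.toRingHom.comp (algebraMap K F) x ∈ w'.asValuationSubring ↔ _
            rw [hιK]
        rcases List.mem_cons.mp hv₀ with rfl | hl
        · -- the new member: `w ∈ U_v`, so `M_v` has a regular centre at the extension of `w`; carry it up `φ₂`
          obtain ⟨w₂, hw₂, hw₂K⟩ := hres (Lv v₀) ι₂
          have hEw : E v₀ w = w₂ := ZariskiRiemannSpace.eq_of_comap_eq (E v₀) (hE v₀) w w₂ hw₂K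
          have hreg₂ : (Mv v₀).toProperModel.RegCentre w₂ := by
            rw [ProjModel.toProperModel_regCentre_iff, ← hEw]
            exact hMv v₀ _ hwU
          letI : Algebra (Lv v₀) L' := ι₂.toRingHom.toAlgebra
          haveI : IsScalarTower k (Lv v₀) L' := IsScalarTower.of_algebraMap_eq fun c => by
            change algebraMap k L' c = ι₂ (algebraMap k (Lv v₀) c)
            rw [IsScalarTower.algebraMap_apply k K (Lv v₀), ι₂.commutes, ← IsScalarTower.algebraMap_apply]
          exact ProperModel.regCentre_of_comap_eq (Mv v₀).toProperModel N' φ₂ h2π h2gen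
            (fun n h => hregle n (Or.inr h)) (w := w₂) (w' := w') hw₂.symm hreg₂
        · -- an old member: regular centre on `N` by induction; carry it up `φ₁`
          obtain ⟨w₁, hw₁, hw₁K⟩ := hres L ι₁
          have hreg₁ : N.RegCentre w₁ := hinv w ⟨v₀, hl, hwU⟩ w₁ hw₁K
          letI : Algebra L L' := ι₁.toRingHom.toAlgebra
          haveI : IsScalarTower k L L' := IsScalarTower.of_algebraMap_eq fun c => by
            change algebraMap k L' c = ι₁ (algebraMap k L c)
            rw [IsScalarTower.algebraMap_apply k K L, ι₁.commutes, ← IsScalarTower.algebraMap_apply]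
          exact ProperModel.regCentre_of_comap_eq N N' φ₁ h1π h1gen
            (fun n h => hregle n (Or.inl h)) (w := w₁) (w' := w') hw₁.symm hreg₁
  /- Step 6: the model patched over the whole finite cover is regular. -/
  obtain ⟨L, iFL, iAL, iaL, itL, hfinL, hpiL, N, φ, hφπ, hφgen, hinv⟩ := key t.toList
  refine ⟨L, iFL, iAL, iaL, itL, hfinL, hpiL, N, φ, hφπ, hφgen, ?_⟩
  refine ProperModel.isRegular_of_forall_regCentre fun w' => ?_
  let w : ZariskiRiemannSpace k K :=
    ⟨w'.asValuationSubring.comap (algebraMap K L), ZariskiRiemannSpace.algebraMap_mem_comap w'⟩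
  obtain ⟨v, hv, hwv⟩ := hcov w
  exact hinv w ⟨v, Finset.mem_toList.mpr hv, hwv⟩ w' rfl

end Summit.ResolutionOfSingularities.ResolutionOfSingularities.Theorems.Pialt.PiPatching

end
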